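import Summits.RiemannHypothesis.RiemannHypothesis.Theses.OddSector
import Summits.RiemannHypothesis.RiemannHypothesis.Theorems.OddSectorOddOneSignedWindowsGoodWindowsClosed
import Mathlib.MeasureTheory.Covering.Vitali
import Mathlib.MeasureTheory.Covering.Besicovitch
import Mathlib.MeasureTheory.Covering.BesicovitchVectorSpace
import HarnessLib

/-!
# The Diophantine core of line `Sketch` ⟺ good windows are not eventually Lebesgue-null
# (RH-free helper for crux `OddSector.OddOneSignedWindows`, item stmt-RiemannHypothesis-17778)

Call a window `a` GOOD when it carries an odd-sector ground state of Weil's windowed form that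
is real and `≥ 0` a.e. on `(0, a)`; the crux `OddOneSignedWindows` says the good set `𝒢` is
unbounded. The registered core `stub_diophantineCore` of the line `Sketch` (card
`resonance-transport-diophantine`, reshaped) says: beyond every height there is a unit interval
`[a₁, a₁ + 1]` and a summable family of radii `ψ N M ≥ 0`, `Σ ψ < 1/2`, such that every window of
the interval off the tubes `|a − log (N/M)| < ψ N M` (`N, M ≥ 1`) is good. This file locates that
core EXACTLY on the measure-theoretic scale (`diophantineCore_iff_volume_goodWindows_ne_zero`):

  core ⟺ for every `A`, `volume (𝒢 ∩ [A, ∞)) ≠ 0`,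
i.e. the core is the crux plus precisely the robustness "good windows are not Lebesgue-null
beyond any height". `⟹`: the tubes have total length `< 1`. `⟸`: take a Lebesgue
density point `g` of the good set beyond `max A 1 + 1` (`Besicovitch.ae_tendsto_measure_inter_div`)
and a radius `δ < 1/8` at which the good set fills `> 39/40` of `[g − δ, g + δ]`; since the good
set is relatively closed in `(0, ∞)` (`goodWindow_of_mem_closure`), the bad windows near `g` form
an open set of measure `≤ δ/20 + δ/50`, which the Vitali covering lemma covers by tubes centred at
the (dense) points `log (N/M)` with radius-sum `≤ 3 ×` that (`exists_logRat_tubes_cover`); one more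
tube of radius `1/2 − δ/4` swallows the far part of the unit interval `[g − δ, g − δ + 1]`; total
`< 1/2`. Consequence for the crux: `OddOneSignedWindows_of_volume_goodWindows_ne_zero`.

References: Vitali covering, Lebesgue density (Mathlib); Bombieri, Rend. Lincei (9) 11 (2000) §4.
-/

noncomputable section

set_option linter.dupNamespace false

open Set MeasureTheory Metric Filter
open scoped ENNReal Topology

namespace Summit.RiemannHypothesis.RiemannHypothesis.Theorems.OddSector

open Literature.NumberTheory.LFunctions
open Summit.RiemannHypothesis.RiemannHypothesis.Theses.OddSector (OddOneSignedWindows)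

/-- **Logarithms of positive rationals are dense in `ℝ`.** For every `x` and `ε > 0` there are
`N, M ≥ 1` with `|x − log (N/M)| < ε`. [folklore] -/
theorem exists_abs_sub_log_div_lt (x : ℝ) {ε : ℝ} (hε : 0 < ε) :
    ∃ N M : ℕ, 1 ≤ N ∧ 1 ≤ M ∧ |x - Real.log ((N : ℝ) / M)| < ε := by
  -- continuity of `log` at `exp x > 0`
  have hcont : ContinuousAt Real.log (Real.exp x) :=
    Real.continuousAt_log (Real.exp_pos x).ne'
  obtain ⟨δ, hδ, hδε⟩ := Metric.continuousAt_iff.1 hcont ε hε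
  -- a positive rational within `min δ (exp x / 2)` of `exp x`
  obtain ⟨q, hq1, hq2⟩ := exists_rat_btwn (show Real.exp x - min δ (Real.exp x / 2) < Real.exp x by
    have := lt_min hδ (half_pos (Real.exp_pos x)); linarith)
  have hqpos : (0 : ℝ) < q := by
    have h1 : min δ (Real.exp x / 2) ≤ Real.exp x / 2 := min_le_right _ _
    linarith [Real.exp_pos x]
  have hqpos' : (0 : ℚ) < q := by exact_mod_cast hqpos
  have hqdist : dist (q : ℝ) (Real.exp x) < δ := by
    rw [Real.dist_eq, abs_sub_lt_iff]
    have h1 : min δ (Real.exp x / 2) ≤ δ := min_le_left _ _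
    constructor <;> linarith
  refine ⟨q.num.toNat, q.den, ?_, q.den_pos, ?_⟩
  · have : 0 < q.num := Rat.num_pos.2 hqpos'
    omega
  · have hnum : ((q.num.toNat : ℕ) : ℝ) = (q.num : ℝ) := by
      have h0 : (0 : ℤ) ≤ q.num := (Rat.num_pos.2 hqpos').le
      exact_mod_cast Int.toNat_of_nonneg h0
    have hq : ((q.num.toNat : ℕ) : ℝ) / (q.den : ℕ) = (q : ℝ) := by
      rw [hnum]
      exact_mod_cast q.num_div_den
    rw [hq]
    have := hδε hqdist
    rw [Real.dist_eq, Real.log_exp] at this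
    rwa [abs_sub_comm]

/-- **Economic covering of an open set by tubes round log-rationals.** For every open `U ⊆ ℝ`
there is a family of radii `Ψ N M ∈ [0, ∞]` with `Σ_{N,M} Ψ N M ≤ 3 · volume U` such that every
point of `U` lies STRICTLY inside some tube: `|x − log (N/M)| < Ψ N M` with `N, M ≥ 1` (in
`ℝ≥0∞`; `Ψ = ∞` allowed if `volume U = ∞`). Proof: Vitali's lemma for the closed balls
`closedBall (log (N/M)) (1/(k+1)) ⊆ U`, enlargement `4`, radii `5/(k+1)`. [folklore] -/
theorem exists_logRat_tubes_cover {U : Set ℝ} (hU : IsOpen U) :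
    ∃ Ψ : ℕ → ℕ → ℝ≥0∞, (∑' p : ℕ × ℕ, Ψ p.1 p.2) ≤ 3 * volume U ∧
      ∀ x ∈ U, ∃ N M : ℕ, 1 ≤ N ∧ 1 ≤ M ∧
        ENNReal.ofReal |x - Real.log ((N : ℝ) / M)| < Ψ N M := by
  classical
  -- centres `log (N/M)` and radii `1/(k+1)` of the index `(N, M, k)`
  set tubeCentre : ℕ × ℕ × ℕ → ℝ := fun i ↦ Real.log ((i.1 : ℝ) / i.2.1) with hc
  set tubeRadius : ℕ × ℕ × ℕ → ℝ := fun i ↦ 1 / ((i.2.2 : ℝ) + 1) with hr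
  have tubeRadius_pos : ∀ i, 0 < tubeRadius i := fun i ↦ by simp only [hr]; positivity
  have tubeRadius_le_one : ∀ i, tubeRadius i ≤ 1 := fun i ↦ by
    simp only [hr]
    rw [div_le_one (by positivity)]
    linarith [(Nat.cast_nonneg i.2.2 : (0 : ℝ) ≤ i.2.2)]
  -- the Vitali family
  set t : Set (ℕ × ℕ × ℕ) := {i | 1 ≤ i.1 ∧ 1 ≤ i.2.1 ∧ closedBall (tubeCentre i) (tubeRadius i) ⊆ U}
    with ht
  obtain ⟨u, hut, hdisj, hcov⟩ := Vitali.exists_disjoint_subfamily_covering_enlargement_closedBall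
    t tubeCentre tubeRadius 1 (fun i _ ↦ tubeRadius_le_one i) 4 (by norm_num)
  -- the radii: `Ψ N M = Σ_k [ (N,M,k) ∈ u ] · 5 r`
  set g : ℕ × ℕ × ℕ → ℝ≥0∞ := u.indicator fun i ↦ ENNReal.ofReal (5 * tubeRadius i) with hg
  refine ⟨fun N M ↦ ∑' k, g (N, M, k), ?_, ?_⟩
  · -- total radius-sum ≤ (5/2) Σ_{b ∈ u} 2 r_b ≤ 3 volume U
    have hsum : (∑' p : ℕ × ℕ, ∑' k, g (p.1, p.2, k)) = ∑' i : ℕ × ℕ × ℕ, g i := by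
      rw [ENNReal.tsum_prod (f := fun N M ↦ ∑' k, g (N, M, k))]
      rw [ENNReal.tsum_prod' (f := g)]
      congr 1 with N
      rw [ENNReal.tsum_prod' (f := fun q : ℕ × ℕ ↦ g (N, q))]
    rw [hsum]
    -- the disjoint balls of `u`, as a family indexed by all of `ℕ × ℕ × ℕ`
    set f : ℕ × ℕ × ℕ → Set ℝ :=
      fun i ↦ if i ∈ u then closedBall (tubeCentre i) (tubeRadius i) else ∅ with hf
    have hfU : (⋃ i, f i) ⊆ U := by
      refine iUnion_subset fun i ↦ ?_
      by_cases hi : i ∈ u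
      · simp only [hf, if_pos hi]; exact (hut hi).2.2
      · simp only [hf, if_neg hi]; exact empty_subset _
    have hfdisj : Pairwise (Function.onFun Disjoint f) := by
      intro i j hij
      by_cases hi : i ∈ u
      · by_cases hj : j ∈ u
        · simp only [Function.onFun, hf, if_pos hi, if_pos hj]
          exact hdisj hi hj hij
        · simp only [Function.onFun, hf, if_neg hj]; exact disjoint_empty _
      · simp only [Function.onFun, hf, if_neg hi]; exact empty_disjoint _
    have hfmeas : ∀ i, MeasurableSet (f i) := fun i ↦ by
      by_cases hi : i ∈ u
      · simp only [hf, if_pos hi]; exact measurableSet_closedBall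
      · simp only [hf, if_neg hi]; exact MeasurableSet.empty
    have hvol : ∀ i, g i ≤ 3 * volume (f i) := fun i ↦ by
      by_cases hi : i ∈ u
      · simp only [hg, hf, indicator_of_mem hi, if_pos hi, Real.volume_closedBall]
        rw [show (3 : ℝ≥0∞) = ENNReal.ofReal 3 by simp, ← ENNReal.ofReal_mul (by norm_num)]
        exact ENNReal.ofReal_le_ofReal (by linarith [tubeRadius_pos i])
      · simp [hg, hi]
    calc ∑' i, g i ≤ ∑' i, 3 * volume (f i) := ENNReal.tsum_le_tsum hvol
      _ = 3 * ∑' i, volume (f i) := ENNReal.tsum_mul_left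
      _ ≤ 3 * volume (⋃ i, f i) := by
          gcongr
          exact tsum_meas_le_meas_iUnion_of_disjoint volume hfmeas hfdisj
      _ ≤ 3 * volume U := by gcongr
  · -- every point of `U` is strictly inside an enlarged tube of the subfamily
    intro x hx
    obtain ⟨ε, hε, hball⟩ := Metric.isOpen_iff.1 hU x hx
    obtain ⟨k, hk⟩ := exists_nat_one_div_lt (half_pos hε)
    obtain ⟨N, M, hN, hM, hNM⟩ := exists_abs_sub_log_div_lt x (show (0 : ℝ) < 1 / ((k : ℝ) + 1) by
      positivity)
    have hi : ((N, M, k) : ℕ × ℕ × ℕ) ∈ t := by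
      refine ⟨hN, hM, fun y hy ↦ hball ?_⟩
      rw [mem_closedBall, Real.dist_eq] at hy
      rw [mem_ball, Real.dist_eq]
      simp only [hc, hr] at hy
      calc |y - x| = |(y - Real.log ((N : ℝ) / M)) - (x - Real.log ((N : ℝ) / M))| := by ring_nf
        _ ≤ |y - Real.log ((N : ℝ) / M)| + |x - Real.log ((N : ℝ) / M)| := abs_sub _ _
        _ < 1 / ((k : ℝ) + 1) + 1 / ((k : ℝ) + 1) := by linarith
        _ < ε := by linarith
    obtain ⟨b, hbu, hb⟩ := hcov _ hi
    have hxb : x ∈ closedBall (tubeCentre b) (4 * tubeRadius b) := by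
      refine hb ?_
      rw [mem_closedBall, Real.dist_eq]
      exact hNM.le
    rw [mem_closedBall, Real.dist_eq] at hxb
    obtain ⟨N', M', k'⟩ := b
    refine ⟨N', M', (hut hbu).1, (hut hbu).2.1, ?_⟩
    have hterm : g (N', M', k') ≤ ∑' k, g (N', M', k) := ENNReal.le_tsum k'
    refine lt_of_lt_of_le ?_ hterm
    simp only [hg, indicator_of_mem hbu]
    rw [ENNReal.ofReal_lt_ofReal_iff (by linarith [tubeRadius_pos (N', M', k')])]
    simp only [hc] at hxb
    linarith [tubeRadius_pos (N', M', k')]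

-- `𝒢` = the set of GOOD WINDOWS (matrix of the crux `OddOneSignedWindows`); local notation only.
set_option quotPrecheck false in
local notation "𝒢" => (setOf fun a : ℝ => ∃ u : ℝ → ℂ, IsWeilOddGroundState a u ∧
  ∀ᵐ t : ℝ, t ∈ Set.Ioo 0 a → (u t).im = 0 ∧ 0 ≤ (u t).re)

/-- **Good windows are relatively closed in `(0, ∞)`**: `𝒢 = closure 𝒢 ∩ (0, ∞)`. [folklore] -/
theorem goodWindows_eq_closure_inter_Ioi : (𝒢 : Set ℝ) = closure 𝒢 ∩ Ioi 0 := by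
  ext a
  refine ⟨fun ha ↦ ⟨subset_closure ha, ?_⟩, fun ha ↦ goodWindow_of_mem_closure ha.2 ha.1⟩
  obtain ⟨u, hu, -⟩ := ha
  exact hu.pos

/-- **The set of good windows is Lebesgue measurable.** [folklore] -/
theorem measurableSet_goodWindows : MeasurableSet (𝒢 : Set ℝ) := by
  rw [goodWindows_eq_closure_inter_Ioi]
  exact isClosed_closure.measurableSet.inter measurableSet_Ioi

/-- **Tubes of total length `< 1` leave positive measure in every unit interval.** [folklore] -/
theorem volume_Icc_diff_tubes_ne_zero (ψ : ℕ → ℕ → ℝ) (h0 : ∀ N M, 0 ≤ ψ N M)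
    (hsum : Summable (fun p : ℕ × ℕ => ψ p.1 p.2)) (hlt : ∑' p : ℕ × ℕ, ψ p.1 p.2 < 1 / 2)
    (a₁ : ℝ) :
    volume (Icc a₁ (a₁ + 1) \ ⋃ p : ℕ × ℕ, ball (Real.log ((p.1 : ℝ) / p.2)) (ψ p.1 p.2)) ≠ 0 := by
  set T := ⋃ p : ℕ × ℕ, ball (Real.log ((p.1 : ℝ) / p.2)) (ψ p.1 p.2) with hT
  have h1 : volume (Icc a₁ (a₁ + 1)) = 1 := by
    rw [Real.volume_Icc, add_sub_cancel_left, ENNReal.ofReal_one]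
  have hnn : ∀ p : ℕ × ℕ, 0 ≤ 2 * ψ p.1 p.2 := fun p => mul_nonneg zero_le_two (h0 p.1 p.2)
  have hs2 : Summable (fun p : ℕ × ℕ => 2 * ψ p.1 p.2) := hsum.mul_left 2
  have hTlt : volume T < 1 := by
    calc volume T ≤ ∑' p : ℕ × ℕ, volume (ball (Real.log ((p.1 : ℝ) / p.2)) (ψ p.1 p.2)) :=
          measure_iUnion_le _
      _ = ∑' p : ℕ × ℕ, ENNReal.ofReal (2 * ψ p.1 p.2) := by simp_rw [Real.volume_ball]
      _ = ENNReal.ofReal (∑' p : ℕ × ℕ, 2 * ψ p.1 p.2) := (ENNReal.ofReal_tsum_of_nonneg hnn hs2).symm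
      _ = ENNReal.ofReal (2 * ∑' p : ℕ × ℕ, ψ p.1 p.2) := by rw [tsum_mul_left]
      _ < 1 := by
          rw [← ENNReal.ofReal_one, ENNReal.ofReal_lt_ofReal_iff one_pos]
          linarith
  intro h0'
  have hle : volume (Icc a₁ (a₁ + 1)) ≤ volume (Icc a₁ (a₁ + 1) \ T) + volume T :=
    (measure_mono (subset_sdiff_union _ _)).trans (measure_union_le _ _)
  rw [h0', zero_add, h1] at hle
  exact absurd hle (not_le.2 hTlt)

/-- **The Diophantine core forces non-null good windows beyond every height.** [folklore] -/
theorem volume_goodWindows_ne_zero_of_diophantineCore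
    (hcore : ∀ A : ℝ, ∃ a₁ : ℝ, A ≤ a₁ ∧ ∃ ψ : ℕ → ℕ → ℝ, (∀ N M, 0 ≤ ψ N M) ∧
      Summable (fun p : ℕ × ℕ => ψ p.1 p.2) ∧ ∑' p : ℕ × ℕ, ψ p.1 p.2 < 1 / 2 ∧
      ∀ a ∈ Icc a₁ (a₁ + 1),
        (∀ N M : ℕ, 1 ≤ N → 1 ≤ M → ψ N M ≤ |a - Real.log ((N : ℝ) / M)|) →
          ∃ u : ℝ → ℂ, IsWeilOddGroundState a u ∧
            ∀ᵐ t : ℝ, t ∈ Ioo 0 a → (u t).im = 0 ∧ 0 ≤ (u t).re)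
    (A : ℝ) : volume ((𝒢 : Set ℝ) ∩ Ici A) ≠ 0 := by
  obtain ⟨a₁, hAa₁, ψ, h0, hsum, hlt, hgood⟩ := hcore A
  intro hz
  refine volume_Icc_diff_tubes_ne_zero ψ h0 hsum hlt a₁ (measure_mono_null (fun a ha ↦ ?_) hz)
  obtain ⟨haI, haT⟩ := ha
  simp only [mem_iUnion, mem_ball, Real.dist_eq, not_exists, not_lt] at haT
  exact ⟨hgood a haI fun N M _ _ ↦ haT (N, M), hAa₁.trans haI.1⟩

/-- **Non-nullness beyond every height forces the Diophantine core** (the converse half). Given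
`A`, take a Lebesgue density point `g ≥ max A 1 + 1` of the good set (Besicovitch/Lebesgue density
theorem) and a radius `δ < 1/8` at which the good set fills `> 39/40` of `[g − δ, g + δ]`; on the
unit interval `[g − δ, g − δ + 1]` the bad windows inside `(g − δ − η, g + δ + η)`, `η = δ/100`, form
an OPEN set of measure `≤ δ/20 + 2η`, covered by log-rational tubes of radius-sum `≤ 3(δ/20 + 2η)`,
and `[g + δ/2, g − δ + 1]` is swallowed by ONE tube of radius `1/2 − δ/4` centred within `δ/8` of
`g + 1/2`; total radius-sum `≤ 1/2 − δ/10 + 6η < 1/2`. [folklore] -/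
theorem diophantineCore_of_volume_goodWindows_ne_zero
    (hvol : ∀ A : ℝ, volume ((𝒢 : Set ℝ) ∩ Ici A) ≠ 0) :
    ∀ A : ℝ, ∃ a₁ : ℝ, A ≤ a₁ ∧ ∃ ψ : ℕ → ℕ → ℝ, (∀ N M, 0 ≤ ψ N M) ∧
      Summable (fun p : ℕ × ℕ => ψ p.1 p.2) ∧ ∑' p : ℕ × ℕ, ψ p.1 p.2 < 1 / 2 ∧
      ∀ a ∈ Icc a₁ (a₁ + 1),
        (∀ N M : ℕ, 1 ≤ N → 1 ≤ M → ψ N M ≤ |a - Real.log ((N : ℝ) / M)|) →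
          ∃ u : ℝ → ℂ, IsWeilOddGroundState a u ∧
            ∀ᵐ t : ℝ, t ∈ Ioo 0 a → (u t).im = 0 ∧ 0 ≤ (u t).re := by
  classical
  intro A
  -- (1) the good windows beyond `A' = max A 1 + 1`: measurable, non-null
  set A' : ℝ := max A 1 + 1 with hA'
  set S : Set ℝ := (𝒢 : Set ℝ) ∩ Ici A' with hS
  have hSm : MeasurableSet S := (measurableSet_goodWindows).inter measurableSet_Ici
  have hS0 : volume S ≠ 0 := hvol A'
  -- (2) a Lebesgue density point `g ∈ S`
  have hae := Besicovitch.ae_tendsto_measure_inter_div volume S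
  have hmem : ∀ᵐ x ∂(volume.restrict S), x ∈ S := ae_restrict_mem hSm
  haveI hne : (ae (volume.restrict S)).NeBot := by
    rw [ae_neBot]
    intro h0
    exact hS0 (Measure.restrict_eq_zero.1 h0)
  obtain ⟨g, hg, hgS⟩ := (hae.and hmem).exists
  have hgA' : A' ≤ g := hgS.2
  have hg1 : (2 : ℝ) ≤ g := by
    have : (1 : ℝ) ≤ max A 1 := le_max_right _ _
    linarith
  -- (3) a radius `δ ∈ (0, 1/8)` with density `> 39/40`
  have hev1 : ∀ᶠ r in 𝓝[>] (0 : ℝ),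
      ENNReal.ofReal (39 / 40) < volume (S ∩ closedBall g r) / volume (closedBall g r) :=
    hg.eventually (lt_mem_nhds (ENNReal.ofReal_lt_one.2 (by norm_num)))
  have hev2 : ∀ᶠ r in 𝓝[>] (0 : ℝ), r ∈ Ioo (0 : ℝ) (1 / 8) := Ioo_mem_nhdsGT (by norm_num)
  obtain ⟨δ, hδdens, hδ0, hδ8⟩ := (hev1.and hev2).exists
  -- (4) the bad measure inside the closed ball is `≤ δ/20`
  have hcb : volume (closedBall g δ) = ENNReal.ofReal (2 * δ) := Real.volume_closedBall g δ
  have hcb_ne_top : volume (closedBall g δ) ≠ ∞ := by rw [hcb]; exact ENNReal.ofReal_ne_top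
  have hcb_ne_zero : volume (closedBall g δ) ≠ 0 := by
    rw [hcb]; exact (ENNReal.ofReal_pos.2 (by linarith)).ne'
  have hdens : ENNReal.ofReal (39 / 40) * volume (closedBall g δ) < volume (S ∩ closedBall g δ) :=
    (ENNReal.lt_div_iff_mul_lt (Or.inl hcb_ne_zero) (Or.inl hcb_ne_top)).1 hδdens
  have hsplit : volume (closedBall g δ ∩ S) + volume (closedBall g δ \ S) =
      volume (closedBall g δ) := measure_inter_add_sdiff _ hSm
  have hin_ne_top : volume (closedBall g δ ∩ S) ≠ ∞ :=
    ne_top_of_le_ne_top hcb_ne_top (measure_mono inter_subset_left)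
  have hout_ne_top : volume (closedBall g δ \ S) ≠ ∞ :=
    ne_top_of_le_ne_top hcb_ne_top (measure_mono sdiff_subset)
  have hbad : volume (closedBall g δ \ S) ≤ ENNReal.ofReal (δ / 20) := by
    have hR := congrArg ENNReal.toReal hsplit
    rw [ENNReal.toReal_add hin_ne_top hout_ne_top, hcb, ENNReal.toReal_ofReal (by linarith)] at hR
    have hW : 39 / 40 * (2 * δ) < (volume (closedBall g δ ∩ S)).toReal := by
      have := ENNReal.toReal_strict_mono hin_ne_top (by rwa [inter_comm] at hdens)
      rwa [hcb, ← ENNReal.ofReal_mul (by norm_num), ENNReal.toReal_ofReal (by positivity)] at this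
    rw [← ENNReal.ofReal_toReal hout_ne_top]
    exact ENNReal.ofReal_le_ofReal (by linarith)
  -- (5) the open set of bad windows near `g`
  set η : ℝ := δ / 100 with hη
  have hη0 : 0 < η := by positivity
  set U : Set ℝ := ball g (δ + η) ∩ (closure (𝒢 : Set ℝ))ᶜ with hU
  have hUo : IsOpen U := isOpen_ball.inter isClosed_closure.isOpen_compl
  have hUvol : volume U ≤ ENNReal.ofReal (δ / 20) + ENNReal.ofReal (2 * η) := by
    have hsub : U ⊆ (closedBall g δ \ S) ∪ (ball g (δ + η) \ closedBall g δ) := by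
      intro x hx
      by_cases hxc : x ∈ closedBall g δ
      · exact Or.inl ⟨hxc, fun hxS ↦ hx.2 (subset_closure hxS.1)⟩
      · exact Or.inr ⟨hx.1, hxc⟩
    have hring : volume (ball g (δ + η) \ closedBall g δ) = ENNReal.ofReal (2 * η) := by
      rw [measure_sdiff (closedBall_subset_ball (by linarith)) measurableSet_closedBall.nullMeasurableSet
        hcb_ne_top, Real.volume_ball, hcb, ← ENNReal.ofReal_sub _ (by linarith)]
      congr 1; ring
    calc volume U ≤ volume (closedBall g δ \ S) + volume (ball g (δ + η) \ closedBall g δ) :=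
          (measure_mono hsub).trans (measure_union_le _ _)
      _ ≤ ENNReal.ofReal (δ / 20) + ENNReal.ofReal (2 * η) := by rw [hring]; gcongr
  -- (6) cover `U` by log-rational tubes, and add ONE big tube for the far part of the interval
  obtain ⟨Ψ, hΨsum, hΨcov⟩ := exists_logRat_tubes_cover hUo
  obtain ⟨N₁, M₁, hN₁, hM₁, hc₁⟩ := exists_abs_sub_log_div_lt (g + 1 / 2) (show (0:ℝ) < δ / 8 by
    positivity)
  set ρ₂ : ℝ := 1 / 2 - δ / 4 with hρ₂
  have hρ₂0 : 0 < ρ₂ := by rw [hρ₂]; linarith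
  set Φ : ℕ × ℕ → ℝ≥0∞ := fun p ↦ if p = (N₁, M₁) then ENNReal.ofReal ρ₂ else 0 with hΦ
  set Ψ' : ℕ → ℕ → ℝ≥0∞ := fun N M ↦ Ψ N M + Φ (N, M) with hΨ'
  have hΦsum : ∑' p : ℕ × ℕ, Φ p = ENNReal.ofReal ρ₂ := by
    rw [tsum_eq_single (N₁, M₁) (fun p hp ↦ if_neg hp)]
    simp
  have hΨ'sum : ∑' p : ℕ × ℕ, Ψ' p.1 p.2 < ENNReal.ofReal (1 / 2) := by
    have h1 : ∑' p : ℕ × ℕ, Ψ' p.1 p.2 = (∑' p : ℕ × ℕ, Ψ p.1 p.2) + ∑' p : ℕ × ℕ, Φ p := by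
      simp only [hΨ']
      exact ENNReal.tsum_add
    rw [h1, hΦsum]
    calc (∑' p : ℕ × ℕ, Ψ p.1 p.2) + ENNReal.ofReal ρ₂
        ≤ 3 * (ENNReal.ofReal (δ / 20) + ENNReal.ofReal (2 * η)) + ENNReal.ofReal ρ₂ := by
          gcongr
          exact hΨsum.trans (by gcongr)
      _ = ENNReal.ofReal (3 * (δ / 20 + 2 * η) + ρ₂) := by
          rw [← ENNReal.ofReal_add (by positivity) (by positivity),
            show (3 : ℝ≥0∞) = ENNReal.ofReal 3 by simp, ← ENNReal.ofReal_mul (by norm_num),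
            ← ENNReal.ofReal_add (by positivity) hρ₂0.le]
      _ < ENNReal.ofReal (1 / 2) := by
          rw [ENNReal.ofReal_lt_ofReal_iff (by norm_num)]
          rw [hρ₂, hη]; linarith
  have hΨ'top : ∑' p : ℕ × ℕ, Ψ' p.1 p.2 ≠ ∞ := (hΨ'sum.trans ENNReal.ofReal_lt_top).ne
  have hΨ'pt : ∀ N M, Ψ' N M ≠ ∞ := fun N M ↦
    ne_top_of_le_ne_top hΨ'top (ENNReal.le_tsum (f := fun p : ℕ × ℕ ↦ Ψ' p.1 p.2) (N, M))
  -- (7) the real-valued exclusion family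
  refine ⟨g - δ, ?_, fun N M ↦ (Ψ' N M).toReal, fun N M ↦ ENNReal.toReal_nonneg, ?_, ?_, ?_⟩
  · have : A ≤ max A 1 := le_max_left _ _
    linarith
  · exact ENNReal.summable_toReal hΨ'top
  · show ∑' p : ℕ × ℕ, (Ψ' p.1 p.2).toReal < 1 / 2
    rw [← ENNReal.tsum_toReal_eq (f := fun p : ℕ × ℕ ↦ Ψ' p.1 p.2) (fun p ↦ hΨ'pt p.1 p.2)]
    exact ENNReal.toReal_lt_of_lt_ofReal hΨ'sum
  -- (8) a window of the interval off all tubes is good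
  intro a ha hfar
  by_contra haG
  rcases le_or_gt a (g + δ / 2) with hnear | hfar'
  · -- near `g`: `a` is a bad window inside the ball, hence in `U`, hence strictly inside a tube
    have hapos : 0 < a := by linarith [ha.1]
    have haU : a ∈ U := by
      refine ⟨?_, fun hacl ↦ haG (goodWindow_of_mem_closure hapos hacl)⟩
      rw [mem_ball, Real.dist_eq, abs_lt]
      constructor <;> linarith [ha.1]
    obtain ⟨N, M, hN, hM, hlt⟩ := hΨcov a haU
    have hlt' : ENNReal.ofReal |a - Real.log ((N : ℝ) / M)| < Ψ' N M :=
      hlt.trans_le (le_self_add)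
    have := (ENNReal.ofReal_lt_iff_lt_toReal (abs_nonneg _) (hΨ'pt N M)).1 hlt'
    linarith [hfar N M hN hM]
  · -- far from `g`: `a` is strictly inside the big tube
    have hbig : |a - Real.log ((N₁ : ℝ) / M₁)| < ρ₂ := by
      rw [abs_sub_lt_iff] at hc₁ ⊢
      constructor <;> linarith [ha.2]
    have hle : ρ₂ ≤ (Ψ' N₁ M₁).toReal := by
      rw [← ENNReal.ofReal_le_iff_le_toReal (hΨ'pt N₁ M₁)]
      simp [hΨ', hΦ]
    linarith [hfar N₁ M₁ hN₁ hM₁]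

/-- **The comparison theorem**: the Diophantine core of line `Sketch` holds iff the good windows
are not Lebesgue-null beyond any height. [folklore] -/
theorem diophantineCore_iff_volume_goodWindows_ne_zero :
    (∀ A : ℝ, ∃ a₁ : ℝ, A ≤ a₁ ∧ ∃ ψ : ℕ → ℕ → ℝ, (∀ N M, 0 ≤ ψ N M) ∧
      Summable (fun p : ℕ × ℕ => ψ p.1 p.2) ∧ ∑' p : ℕ × ℕ, ψ p.1 p.2 < 1 / 2 ∧
      ∀ a ∈ Icc a₁ (a₁ + 1),
        (∀ N M : ℕ, 1 ≤ N → 1 ≤ M → ψ N M ≤ |a - Real.log ((N : ℝ) / M)|) →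
          ∃ u : ℝ → ℂ, IsWeilOddGroundState a u ∧
            ∀ᵐ t : ℝ, t ∈ Ioo 0 a → (u t).im = 0 ∧ 0 ≤ (u t).re) ↔
    ∀ A : ℝ, volume ({a : ℝ | ∃ u : ℝ → ℂ, IsWeilOddGroundState a u ∧
      ∀ᵐ t : ℝ, t ∈ Ioo 0 a → (u t).im = 0 ∧ 0 ≤ (u t).re} ∩ Ici A) ≠ 0 :=
  ⟨volume_goodWindows_ne_zero_of_diophantineCore, diophantineCore_of_volume_goodWindows_ne_zero⟩

/-- **Consequence for the crux**: non-null good windows beyond every height give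
`OddOneSignedWindows` (a non-null set is nonempty). [folklore] -/
theorem OddOneSignedWindows_of_volume_goodWindows_ne_zero
    (hvol : ∀ A : ℝ, volume ({a : ℝ | ∃ u : ℝ → ℂ, IsWeilOddGroundState a u ∧
      ∀ᵐ t : ℝ, t ∈ Ioo 0 a → (u t).im = 0 ∧ 0 ≤ (u t).re} ∩ Ici A) ≠ 0) : OddOneSignedWindows := by
  rw [oddOneSignedWindows_iff]
  intro A
  obtain ⟨a, haG, haA⟩ := nonempty_of_measure_ne_zero (hvol A)
  exact ⟨a, haA, haG⟩

end Summit.RiemannHypothesis.RiemannHypothesis.Theorems.OddSector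

end
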